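import Summits.QuantumAdvantage.QuantumAdvantage.Theorems.CubicForrelationNearExactIsExactCubicFormR2Frame
import Summits.QuantumAdvantage.QuantumAdvantage.Theorems.CubicForrelationNearExactIsExactCubicFormTensor
import Summits.QuantumAdvantage.QuantumAdvantage.Theorems.CubicForrelationNearExactIsExactTwelvePartnerSymplectic
import Summits.QuantumAdvantage.QuantumAdvantage.Theorems.CubicForrelationNearExactIsExactCubicFormFrameK
import Summits.QuantumAdvantage.QuantumAdvantage.Theorems.CubicForrelationNearExactIsExactTwelveOddWeightR4Dual

/-!
# Crux `CubicForrelation.NearExactIsExact` (stmt-QuantumAdvantage-14043) — E1280-even, R4 branch, step 1: the partner data IN THE ADAPTED R4 FRAME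

Certificate seat `b2b-cforr-cert` (gen 42).  HONEST FRAMING: kernel-checked bookkeeping (standard axioms) — the first step of the branch
statement `HR4` of `tpw_weight_ge_1280_of_branches` (…TwelvePartnerLight), the R4 analogue of …CubicFormR2Partner: it moves a cubic `κ` on
`5 + 7 = 12` bits with an R4 direction (`#{κ ≠ κ(·⊕a)} = 1536`), its cubic form `d` and a pairing partner `c` into the ADAPTED R4 FRAME of
R4-PARTNER.md §1 (coordinates `y_a = e₀`, `v₀..v₃ = e₁..e₄`, `z₀..z₆ = e₅..e₁₁`), in which `κ'(y) ⊕ κ'(y ⊕ e₀) = v₀v₁ ⊕ v₂v₃`.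
Nothing about `θ₁₂`; NOT summit progress.

* `tpw_third_of_r4_slice`: if `κ(y) ⊕ κ(y ⊕ a) = y_{i₁}y_{i₂} ⊕ y_{i₃}y_{i₄}` then the third derivative of `κ` along `(a, u, v)` is
  `u_{i₁}v_{i₂} ⊕ u_{i₂}v_{i₁} ⊕ u_{i₃}v_{i₄} ⊕ u_{i₄}v_{i₃}` (the R4 analogue of `tct_third_of_product_slice`).
* `tpw_R4_adapted`: from `κ` cubic and `a ≠ 0` with `1536` changes: an invertible `P` over `𝔽₂` whose column `e₀` is `a` such that
  `κ(P y) ⊕ κ(P y ⊕ a) = (b₁ ⊕ y₁)(b₂ ⊕ y₂) ⊕ (b₃ ⊕ y₃)(b₄ ⊕ y₄)` — from `tow_R4_frame` (Dickson frame of the rank-4 quadratic `D_aκ`),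
  `tow_R4_forms` (its four affine derivatives as parity forms with a dual family, all `⊥ a`) and `tcg_adapted_frame_dir` (the frame; its
  direction column is moved from the last to the first coordinate by the cyclic permutation `finRotate`).
* `tpw_R4_partner_frame` (**main**): from `κ` (cubic), `c` (symmetric, zero diagonals), `d` (the cubic form of `κ` at unit vectors, symmetric
  with zero diagonals), `(PAIR)` and `a ≠ 0` with `1536` changes, there are `κ', c', d'` on the same `12` bits with: `κ'` cubic of the same
  weight; `c'` symmetric with zero diagonals; `d'` the cubic form of `κ'`; `(PAIR)` for `(c', d')`; the FRAME IDENTITY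
  `κ'(y) ⊕ κ'(y ⊕ e₀) = y₁y₂ ⊕ y₃y₄`; and `hF`: `d'(e₀, j, k) = [{j,k} = {1,2}] + [{j,k} = {3,4}]` (so `d ∋ y_a∧(v₀v₁ + v₂v₃)` and no other
  monomial with `y_a`, R4-PARTNER §1).
Ingredients as in …CubicFormR2Partner: `tct_comp_isDegLeFun`, `tct_card_comp_eq`, `tct_third_comp_coord` (3-form law), `tcx_transport_hyps`,
`tps_pair_covariant` (covariance of `(PAIR)`), and the Boolean identity of `tpw_key_F1`.

References: this seat lineage (g37 R4-PARTNER §1, g39 HANDPROOFS §2, g40 frame layer); L. E. Dickson (1901).  Axioms: the standard three.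
-/

set_option linter.dupNamespace false -- D-0017: single-problem summit ⇒ `QuantumAdvantage.QuantumAdvantage` by design

namespace Summit.QuantumAdvantage.QuantumAdvantage.Theorems.CubicForrelation.NearExactIsExact

open Finset
open Literature.Computability.QuantumComplexity
open Literature.Computability.QuantumComplexity.BuzetChailloux (bxor zeroVec bxor_comm bxor_self bxor_zeroVec zeroVec_bxor
  bxor_bxor_cancel_left)

/-- **Third derivative from an R4 slice.**  If `κ(y) ⊕ κ(y ⊕ a) = y_{i₁}y_{i₂} ⊕ y_{i₃}y_{i₄}` for all `y`, then for all `u, v, x` the third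
derivative of `κ` along `(a, u, v)` at `x` equals `u_{i₁}v_{i₂} ⊕ u_{i₂}v_{i₁} ⊕ u_{i₃}v_{i₄} ⊕ u_{i₄}v_{i₃}`. [folklore] -/
theorem tpw_third_of_r4_slice {n : ℕ} (κ : (Fin n → Bool) → Bool) (a : Fin n → Bool) (i₁ i₂ i₃ i₄ : Fin n)
    (hq : ∀ y, (κ y ^^ κ (bxor y a)) = ((y i₁ && y i₂) ^^ (y i₃ && y i₄))) (u v x : Fin n → Bool) :
    (((κ x ^^ κ (bxor x a)) ^^ (κ (bxor x v) ^^ κ (bxor (bxor x v) a))) ^^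
        ((κ (bxor x u) ^^ κ (bxor (bxor x u) a)) ^^ (κ (bxor (bxor x u) v) ^^ κ (bxor (bxor (bxor x u) v) a)))) =
      (((u i₁ && v i₂) ^^ (u i₂ && v i₁)) ^^ ((u i₃ && v i₄) ^^ (u i₄ && v i₃))) := by
  rw [hq, hq, hq, hq]
  clear hq
  simp only [bxor]
  generalize x i₁ = x₁; generalize x i₂ = x₂; generalize x i₃ = x₃; generalize x i₄ = x₄
  generalize u i₁ = u₁; generalize u i₂ = u₂; generalize u i₃ = u₃; generalize u i₄ = u₄
  generalize v i₁ = v₁; generalize v i₂ = v₂; generalize v i₃ = v₃; generalize v i₄ = v₄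
  revert x₁ x₂ x₃ x₄ u₁ u₂ u₃ u₄ v₁ v₂ v₃ v₄
  decide

/-- **The adapted R4 frame.**  Let `κ` be cubic on `12 = 5 + 7` bits and `a ≠ 0` a direction along which exactly `1536` points change
value.  Then there is an invertible matrix `P` over `𝔽₂` (inverse `Pi`) whose column `e₀` is `a`, and bits `b₁..b₄`, such that for every `y`,
with `x = P y`: `κ(x) ⊕ κ(x ⊕ a) = (b₁ ⊕ y₁)(b₂ ⊕ y₂) ⊕ (b₃ ⊕ y₃)(b₄ ⊕ y₄)` (coordinates `eₜ = Fin.castAdd 7 t`).  Proof: `D_aκ` is a quadratic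
with `1536` ones and period `a`; `tow_R4_frame` + `tow_R4_forms` write it as `φ₀φ₁ ⊕ φ₂φ₃` with affine parities `φₜ = bₜ ⊕ ⟨·, cₜ⟩` having a
dual family and `⟨a, cₜ⟩ = 0`; `tcg_adapted_frame_dir` gives the frame (direction in the last column), and the cyclic permutation `finRotate`
of the columns moves the direction to column `e₀` and the forms to `e₁..e₄`. [cite: MacWilliamsSloane1977, Ch. 15 §2 Thm 4] -/
theorem tpw_R4_adapted (κ : (Fin (5 + 7) → Bool) → Bool) (hκ : IsDegLeFun 3 κ) (a : Fin (5 + 7) → Bool) (ha : a ≠ zeroVec)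
    (hDa : #(univ.filter fun x : Fin (5 + 7) → Bool => (κ x ^^ κ (bxor x a)) = true) = 1536) :
    ∃ (P Pi : Fin (5 + 7) → Fin (5 + 7) → ZMod 2) (b₁ b₂ b₃ b₄ : Bool),
      (∀ ψ ω, (∑ φ, P ψ φ * Pi φ ω) = if ψ = ω then 1 else 0) ∧
      (∀ ψ ω, (∑ φ, Pi ψ φ * P φ ω) = if ψ = ω then 1 else 0) ∧
      (∀ ψ, P ψ (Fin.castAdd 7 (0 : Fin 5)) = if a ψ = true then 1 else 0) ∧
      ∀ y : Fin (5 + 7) → Bool, (κ (fun ψ => decide ((∑ φ, P ψ φ * (if y φ = true then (1 : ZMod 2) else 0)) = 1)) ^^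
            κ (bxor (fun ψ => decide ((∑ φ, P ψ φ * (if y φ = true then (1 : ZMod 2) else 0)) = 1)) a)) =
        (((b₁ ^^ y (Fin.castAdd 7 (1 : Fin 5))) && (b₂ ^^ y (Fin.castAdd 7 (2 : Fin 5)))) ^^
          ((b₃ ^^ y (Fin.castAdd 7 (3 : Fin 5))) && (b₄ ^^ y (Fin.castAdd 7 (4 : Fin 5))))) := by
  -- the derivative `q = D_aκ`: quadratic, `1536` ones, period `a`
  set q : (Fin (5 + 7) → Bool) → Bool := fun x => κ x ^^ κ (bxor x a) with hq_def
  have hq2 : IsDegLeFun 2 q := stub_derivDegree (5 + 7) 2 κ a hκ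
  have hqw : #(univ.filter fun x : Fin (5 + 7) → Bool => q x = true) = 1536 := hDa
  have hqa : ∀ x, q (bxor x a) = q x := by
    intro x
    show (κ (bxor x a) ^^ κ (bxor (bxor x a) a)) = (κ x ^^ κ (bxor x a))
    rw [iw_bxor_assoc, bxor_self, bxor_zeroVec, Bool.xor_comm]
  obtain ⟨a₀, a₁, a₂, a₃, h01, h23, h02, h03, h12, h13, hprod⟩ := tow_R4_frame q hq2 hqw
  obtain ⟨c₀, c₁, c₂, c₃, y₅, b₀, b₁, b₂, b₃, hψ₀, hψ₁, hψ₂, hψ₃, -, hdual⟩ :=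
    tow_R4_forms q hq2 a ha hqa a₀ a₁ a₂ a₃ h01 h23 h02 h03 h12 h13
  -- the dual family of the four forms, and `a ⊥ cₜ`
  have hcons : ∀ i : Fin 4, ((![a₀, a₁, a₂, a₃, a] : Fin 5 → Fin (5 + 7) → Bool) (Fin.castSucc i)) =
        (![a₀, a₁, a₂, a₃] : Fin 4 → Fin (5 + 7) → Bool) i ∧
      ((![c₀, c₁, c₂, c₃, y₅] : Fin 5 → Fin (5 + 7) → Bool) (Fin.castSucc i)) =
        (![c₀, c₁, c₂, c₃] : Fin 4 → Fin (5 + 7) → Bool) i := by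
    intro i; fin_cases i <;> exact ⟨rfl, rfl⟩
  have hdual4 : ∀ i i' : Fin 4, decide (Odd #(univ.filter fun j => (![a₀, a₁, a₂, a₃] : Fin 4 → Fin (5 + 7) → Bool) i j &&
      (![c₀, c₁, c₂, c₃] : Fin 4 → Fin (5 + 7) → Bool) i' j)) = decide (i = i') := by
    intro i i'
    have h := hdual (Fin.castSucc i') (Fin.castSucc i)
    rw [(hcons i).1, (hcons i').2] at h
    rw [h]
    by_cases hii : i = i'
    · subst hii; simp
    · rw [decide_eq_false (fun h' => hii (Fin.castSucc_injective _ h').symm), decide_eq_false hii]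
  have haz : ∀ i : Fin 4, decide (Odd #(univ.filter fun j => a j && (![c₀, c₁, c₂, c₃] : Fin 4 → Fin (5 + 7) → Bool) i j)) = false := by
    intro i
    have h := hdual (Fin.castSucc i) (Fin.last 4)
    have e1 : ((![a₀, a₁, a₂, a₃, a] : Fin 5 → Fin (5 + 7) → Bool) (Fin.last 4)) = a := rfl
    rw [e1, (hcons i).2] at h
    rw [h]
    exact decide_eq_false (fun h' => (Fin.castSucc_lt_last i).ne h')
  obtain ⟨hk, P₀, Pi₀, hPPi₀, hPiP₀, hP₀a, hP₀z⟩ :=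
    tcg_adapted_frame_dir a ha (![c₀, c₁, c₂, c₃]) (![a₀, a₁, a₂, a₃]) hdual4 haz
  -- move the direction column first: `P ψ φ = P₀ ψ (ρ⁻¹ φ)` with `ρ = finRotate 12`
  have hρ0 : (finRotate (5 + 7)).symm (Fin.castAdd 7 (0 : Fin 5)) = ⟨5 + 7 - 1, by decide⟩ := by decide
  have hρs : ∀ (h : 4 ≤ 5 + 7) (i : Fin 4), (finRotate (5 + 7)) (Fin.castLE h i) = Fin.castAdd 7 i.succ := by decide
  refine ⟨fun ψ φ => P₀ ψ ((finRotate (5 + 7)).symm φ), fun φ ω => Pi₀ ((finRotate (5 + 7)).symm φ) ω, b₀, b₁, b₂, b₃,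
    ?_, ?_, ?_, ?_⟩
  · intro ψ ω
    rw [← hPPi₀ ψ ω]
    exact Equiv.sum_comp (finRotate (5 + 7)).symm (fun φ => P₀ ψ φ * Pi₀ φ ω)
  · intro ψ ω
    show (∑ φ, Pi₀ ((finRotate (5 + 7)).symm ψ) φ * P₀ φ ((finRotate (5 + 7)).symm ω)) = _
    rw [hPiP₀]
    simp only [Equiv.apply_eq_iff_eq]
  · intro ψ
    show P₀ ψ ((finRotate (5 + 7)).symm (Fin.castAdd 7 (0 : Fin 5))) = _
    rw [hρ0]; exact hP₀a ψ
  · intro y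
    have hlin : (fun ψ => decide ((∑ φ, P₀ ψ ((finRotate (5 + 7)).symm φ) * (if y φ = true then (1 : ZMod 2) else 0)) = 1)) =
        (fun ψ => decide ((∑ φ, P₀ ψ φ * (if y ((finRotate (5 + 7)) φ) = true then (1 : ZMod 2) else 0)) = 1)) := by
      funext ψ
      have hs : (∑ φ, P₀ ψ ((finRotate (5 + 7)).symm φ) * (if y φ = true then (1 : ZMod 2) else 0)) =
          ∑ φ, P₀ ψ φ * (if y ((finRotate (5 + 7)) φ) = true then (1 : ZMod 2) else 0) := by
        rw [← Equiv.sum_comp (finRotate (5 + 7))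
          (fun φ => P₀ ψ ((finRotate (5 + 7)).symm φ) * (if y φ = true then (1 : ZMod 2) else 0))]
        simp only [Equiv.symm_apply_apply]
      rw [hs]
    rw [hlin]
    set x : Fin (5 + 7) → Bool :=
      fun ψ => decide ((∑ φ, P₀ ψ φ * (if y ((finRotate (5 + 7)) φ) = true then (1 : ZMod 2) else 0)) = 1) with hx
    have hqx : (κ x ^^ κ (bxor x a)) = q x := rfl
    rw [hqx, hprod x, hψ₀ x, hψ₁ x, hψ₂ x, hψ₃ x]
    have hpar : ∀ i : Fin 4, decide (Odd #(univ.filter fun j => x j && (![c₀, c₁, c₂, c₃] : Fin 4 → Fin (5 + 7) → Bool) i j)) =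
        y (Fin.castAdd 7 i.succ) := by
      intro i
      have h := hP₀z i (fun φ => y ((finRotate (5 + 7)) φ))
      dsimp only at h
      rw [hρs] at h
      exact h
    have e0 : decide (Odd #(univ.filter fun j => x j && c₀ j)) = y (Fin.castAdd 7 (1 : Fin 5)) := hpar 0
    have e1 : decide (Odd #(univ.filter fun j => x j && c₁ j)) = y (Fin.castAdd 7 (2 : Fin 5)) := hpar 1
    have e2 : decide (Odd #(univ.filter fun j => x j && c₂ j)) = y (Fin.castAdd 7 (3 : Fin 5)) := hpar 2
    have e3 : decide (Odd #(univ.filter fun j => x j && c₃ j)) = y (Fin.castAdd 7 (4 : Fin 5)) := hpar 3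
    rw [e0, e1, e2, e3]

/-- **R4, step 1: the partner data in the adapted frame.**  Let `κ` be cubic on `12 = 5 + 7` bits, `d` its cubic form at unit vectors
(`hd`; symmetric with zero diagonals: `hds`, `hdd`), `c` a symmetric pairing partner (`hcs`, `hcc`, `hcd`, `hpair`), and `a ≠ 0` a direction
with exactly `1536` points `x` where `κ x ≠ κ(x ⊕ a)` (case R4).  Then, after an affine change of frame (`tpw_R4_adapted` followed by the
translation removing the offsets `b₁..b₄`), we obtain `κ', c', d'` with: `κ'` cubic, `wt κ' = wt κ`, `c'` symmetric with zero diagonals, `d'` the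
cubic form of `κ'` at unit vectors, `(PAIR)` for `(c', d')` (`tps_pair_covariant`), the FRAME IDENTITY `κ'(y) ⊕ κ'(y ⊕ e₀) = y₁y₂ ⊕ y₃y₄`
(`y_a = e₀`, `v₀..v₃ = e₁..e₄`), and `hF`: `d'(e₀,j,k) = [{j,k} = {e₁,e₂}] + [{j,k} = {e₃,e₄}]` (`tpw_third_of_r4_slice`). [this work] -/
theorem tpw_R4_partner_frame (κ : (Fin (5 + 7) → Bool) → Bool) (hκ : IsDegLeFun 3 κ)
    (c d : Fin (5 + 7) → Fin (5 + 7) → Fin (5 + 7) → ZMod 2)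
    (hcs : ∀ p j k, c p k j = c p j k) (hcc : ∀ p j k, c j p k = c p j k) (hcd : ∀ p j, c p j j = 0)
    (hds : ∀ φ j k, d φ k j = d φ j k) (hdd : ∀ φ j, d φ j j = 0)
    (hd : ∀ φ j k, d φ j k =
      if ((((κ zeroVec ^^ κ (bxor zeroVec (fun l => decide (l = k)))) ^^
            (κ (bxor zeroVec (fun l => decide (l = j))) ^^ κ (bxor (bxor zeroVec (fun l => decide (l = j))) (fun l => decide (l = k))))) ^^
          ((κ (bxor zeroVec (fun l => decide (l = φ))) ^^ κ (bxor (bxor zeroVec (fun l => decide (l = φ))) (fun l => decide (l = k)))) ^^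
            (κ (bxor (bxor zeroVec (fun l => decide (l = φ))) (fun l => decide (l = j))) ^^
              κ (bxor (bxor (bxor zeroVec (fun l => decide (l = φ))) (fun l => decide (l = j))) (fun l => decide (l = k))))))) = true
      then 1 else 0)
    (hpair : ∀ p φ, (∑ j, ∑ k, (if j < k then c p j k * d φ j k else 0)) = if p = φ then 1 else 0)
    (a : Fin (5 + 7) → Bool) (ha : a ≠ zeroVec)
    (hDa : #(univ.filter fun x : Fin (5 + 7) → Bool => (κ x ^^ κ (bxor x a)) = true) = 1536) :
    ∃ (κ' : (Fin (5 + 7) → Bool) → Bool) (c' d' : Fin (5 + 7) → Fin (5 + 7) → Fin (5 + 7) → ZMod 2),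
      IsDegLeFun 3 κ' ∧
      #(univ.filter fun y : Fin (5 + 7) → Bool => κ' y = true) = #(univ.filter fun x : Fin (5 + 7) → Bool => κ x = true) ∧
      (∀ p j k, c' p k j = c' p j k) ∧ (∀ p j k, c' j p k = c' p j k) ∧ (∀ p j, c' p j j = 0) ∧
      (∀ φ j k, d' φ j k =
        if ((((κ' zeroVec ^^ κ' (bxor zeroVec (fun l => decide (l = k)))) ^^
                (κ' (bxor zeroVec (fun l => decide (l = j))) ^^ κ' (bxor (bxor zeroVec (fun l => decide (l = j))) (fun l => decide (l = k))))) ^^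
              ((κ' (bxor zeroVec (fun l => decide (l = φ))) ^^ κ' (bxor (bxor zeroVec (fun l => decide (l = φ))) (fun l => decide (l = k)))) ^^
                (κ' (bxor (bxor zeroVec (fun l => decide (l = φ))) (fun l => decide (l = j))) ^^
                  κ' (bxor (bxor (bxor zeroVec (fun l => decide (l = φ))) (fun l => decide (l = j))) (fun l => decide (l = k))))))) = true
        then 1 else 0) ∧
      (∀ p φ, (∑ j, ∑ k, (if j < k then c' p j k * d' φ j k else 0)) = if p = φ then 1 else 0) ∧
      (∀ y, (κ' y ^^ κ' (bxor y (fun l => decide (l = Fin.castAdd 7 (0 : Fin 5))))) =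
        ((y (Fin.castAdd 7 (1 : Fin 5)) && y (Fin.castAdd 7 (2 : Fin 5))) ^^
          (y (Fin.castAdd 7 (3 : Fin 5)) && y (Fin.castAdd 7 (4 : Fin 5))))) ∧
      (∀ j k, d' (Fin.castAdd 7 (0 : Fin 5)) j k =
        (if (j = Fin.castAdd 7 (1 : Fin 5) ∧ k = Fin.castAdd 7 (2 : Fin 5)) ∨ (j = Fin.castAdd 7 (2 : Fin 5) ∧ k = Fin.castAdd 7 (1 : Fin 5))
          then 1 else 0) +
        (if (j = Fin.castAdd 7 (3 : Fin 5) ∧ k = Fin.castAdd 7 (4 : Fin 5)) ∨ (j = Fin.castAdd 7 (4 : Fin 5) ∧ k = Fin.castAdd 7 (3 : Fin 5))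
          then 1 else 0)) := by
  obtain ⟨P, Pi, b₁, b₂, b₃, b₄, hPPi, hPiP, hP0, hD₁⟩ := tpw_R4_adapted κ hκ a ha hDa
  -- distinctness of the frame coordinates
  have hne : ∀ s t : Fin 5, s ≠ t → (Fin.castAdd 7 s) ≠ Fin.castAdd 7 t := fun s t hst h => hst (Fin.castAdd_injective _ _ h)
  -- the translation `t = (0, b₁, b₂, b₃, b₄, 0, …)` removing the offsets, and `b := P t`
  obtain ⟨t, ht1, ht2, ht3, ht4⟩ : ∃ t : Fin (5 + 7) → Bool, t (Fin.castAdd 7 (1 : Fin 5)) = b₁ ∧ t (Fin.castAdd 7 (2 : Fin 5)) = b₂ ∧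
      t (Fin.castAdd 7 (3 : Fin 5)) = b₃ ∧ t (Fin.castAdd 7 (4 : Fin 5)) = b₄ :=
    ⟨fun l => (decide (l = Fin.castAdd 7 (1 : Fin 5)) && b₁) || (decide (l = Fin.castAdd 7 (2 : Fin 5)) && b₂) ||
        (decide (l = Fin.castAdd 7 (3 : Fin 5)) && b₃) || (decide (l = Fin.castAdd 7 (4 : Fin 5)) && b₄),
      by simp, by simp, by simp, by simp⟩
  obtain ⟨b, hb⟩ : ∃ b : Fin (5 + 7) → Bool,
      b = fun ψ => decide ((∑ φ, P ψ φ * (if t φ = true then (1 : ZMod 2) else 0)) = 1) := ⟨_, rfl⟩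
  obtain ⟨κ', hfun⟩ : ∃ κ' : (Fin (5 + 7) → Bool) → Bool,
      κ' = fun y => κ (bxor b (fun ψ => decide ((∑ φ, P ψ φ * (if y φ = true then (1 : ZMod 2) else 0)) = 1))) := ⟨_, rfl⟩
  have hκ'ap : ∀ y, κ' y = κ (bxor b (fun ψ => decide ((∑ φ, P ψ φ * (if y φ = true then (1 : ZMod 2) else 0)) = 1))) :=
    fun y => by rw [hfun]
  have hκ₁eq : ∀ y, κ' y =
      κ (fun ψ => decide ((∑ φ, P ψ φ * (if (bxor y t) φ = true then (1 : ZMod 2) else 0)) = 1)) := by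
    intro y
    rw [hκ'ap y, hb, tct_lin_bxor P y t, bxor_comm]
  -- the column `e₀` of `P` is `a`
  have hPe0 : (fun ψ => decide ((∑ φ, P ψ φ * (if (fun l => decide (l = Fin.castAdd 7 (0 : Fin 5))) φ = true then (1 : ZMod 2) else 0))
      = 1)) = a := by
    have h := tct_lin_single P (Fin.castAdd 7 (0 : Fin 5))
    have : (fun ψ => decide ((∑ φ, P ψ φ * (if (fun l => decide (l = Fin.castAdd 7 (0 : Fin 5))) φ = true then (1 : ZMod 2) else 0))
        = 1)) = fun ψ => decide ((∑ φ', P ψ φ' * (if decide (φ' = Fin.castAdd 7 (0 : Fin 5)) = true then (1 : ZMod 2) else 0)) = 1) := rfl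
    rw [this, h]
    funext ψ
    rw [hP0]
    cases a ψ <;> decide
  -- the transported tensors
  obtain ⟨d', hd'⟩ : ∃ d' : Fin (5 + 7) → Fin (5 + 7) → Fin (5 + 7) → ZMod 2,
      ∀ φ j k, d' φ j k = ∑ ψ, ∑ α, ∑ β, P ψ φ * P α j * P β k * d ψ α β := ⟨_, fun _ _ _ => rfl⟩
  obtain ⟨c', hc'⟩ : ∃ c' : Fin (5 + 7) → Fin (5 + 7) → Fin (5 + 7) → ZMod 2,
      ∀ p j k, c' p j k = ∑ q, ∑ α, ∑ β, Pi p q * Pi j α * Pi k β * c q α β := ⟨_, fun _ _ _ => rfl⟩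
  -- the frame identity with zero offsets
  have hD' : ∀ y, (κ' y ^^ κ' (bxor y (fun l => decide (l = Fin.castAdd 7 (0 : Fin 5))))) =
      ((y (Fin.castAdd 7 (1 : Fin 5)) && y (Fin.castAdd 7 (2 : Fin 5))) ^^
        (y (Fin.castAdd 7 (3 : Fin 5)) && y (Fin.castAdd 7 (4 : Fin 5)))) := by
    intro y
    have hassoc : bxor (bxor y (fun l => decide (l = Fin.castAdd 7 (0 : Fin 5)))) t =
        bxor (bxor y t) (fun l => decide (l = Fin.castAdd 7 (0 : Fin 5))) := by
      rw [iw_bxor_assoc, bxor_comm (fun l => decide (l = Fin.castAdd 7 (0 : Fin 5))) t, ← iw_bxor_assoc]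
    rw [hκ₁eq y, hκ₁eq (bxor y _), hassoc, tct_lin_bxor P (bxor y t) (fun l => decide (l = Fin.castAdd 7 (0 : Fin 5))), hPe0,
      hD₁ (bxor y t)]
    show (((b₁ ^^ (y _ ^^ t _)) && (b₂ ^^ (y _ ^^ t _))) ^^ ((b₃ ^^ (y _ ^^ t _)) && (b₄ ^^ (y _ ^^ t _)))) = _
    rw [ht1, ht2, ht3, ht4]
    generalize y (Fin.castAdd 7 (1 : Fin 5)) = y₁; generalize y (Fin.castAdd 7 (2 : Fin 5)) = y₂
    generalize y (Fin.castAdd 7 (3 : Fin 5)) = y₃; generalize y (Fin.castAdd 7 (4 : Fin 5)) = y₄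
    revert y₁ y₂ y₃ y₄
    cases b₁ <;> cases b₂ <;> cases b₃ <;> cases b₄ <;> decide
  -- `d'` is the cubic form of `κ'` (the 3-form law)
  have hd'T : ∀ φ j k, d' φ j k =
      if ((((κ' zeroVec ^^ κ' (bxor zeroVec (fun l => decide (l = k)))) ^^
                (κ' (bxor zeroVec (fun l => decide (l = j))) ^^ κ' (bxor (bxor zeroVec (fun l => decide (l = j))) (fun l => decide (l = k))))) ^^
              ((κ' (bxor zeroVec (fun l => decide (l = φ))) ^^ κ' (bxor (bxor zeroVec (fun l => decide (l = φ))) (fun l => decide (l = k)))) ^^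
                (κ' (bxor (bxor zeroVec (fun l => decide (l = φ))) (fun l => decide (l = j))) ^^
                  κ' (bxor (bxor (bxor zeroVec (fun l => decide (l = φ))) (fun l => decide (l = j))) (fun l => decide (l = k))))))) = true
      then 1 else 0 := by
    intro φ j k
    have h := tct_third_comp_coord κ P b hκ φ j k zeroVec zeroVec
    dsimp only at h
    rw [hfun]
    dsimp only
    rw [h, hd']
    exact Finset.sum_congr rfl fun ψ _ => Finset.sum_congr rfl fun α _ => Finset.sum_congr rfl fun β _ => by rw [hd ψ α β]
  refine ⟨κ', c', d', ?_, ?_, ?_, ?_, ?_, hd'T, ?_, hD', ?_⟩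
  · rw [hfun]; exact tct_comp_isDegLeFun κ hκ P b
  · rw [hfun]; exact tct_card_comp_eq P Pi κ hPPi hPiP b
  · intro p j k; rw [hc', hc']; exact (tcx_transport_hyps c Pi hcs hcc hcd).1 p j k
  · intro p j k; rw [hc', hc']; exact (tcx_transport_hyps c Pi hcs hcc hcd).2.1 p j k
  · intro p j; rw [hc']; exact (tcx_transport_hyps c Pi hcs hcc hcd).2.2 p j
  · -- covariance of (PAIR)
    intro p φ
    have h := tps_pair_covariant c d hcs hcd hds hdd hpair (Matrix.of fun ψ φ => P ψ φ) (Matrix.of fun ψ φ => Pi ψ φ)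
      (tcr2_matrix_inv P Pi hPiP) p φ
    simp only [Matrix.of_apply] at h
    rw [← h]
    exact Finset.sum_congr rfl fun j _ => Finset.sum_congr rfl fun k _ => by rw [hc', hd']
  · -- hF from the frame identity
    intro j k
    have h1 : d' (Fin.castAdd 7 (0 : Fin 5)) j k = d' j k (Fin.castAdd 7 (0 : Fin 5)) := by
      rw [hd'T (Fin.castAdd 7 (0 : Fin 5)) j k, hd'T j k (Fin.castAdd 7 (0 : Fin 5)),
        tcf_third_swap12 κ' (fun l => decide (l = Fin.castAdd 7 (0 : Fin 5))) (fun l => decide (l = j)) (fun l => decide (l = k)) zeroVec,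
        tcf_third_swap23 κ' (fun l => decide (l = j)) (fun l => decide (l = Fin.castAdd 7 (0 : Fin 5))) (fun l => decide (l = k)) zeroVec]
    rw [h1, hd'T j k (Fin.castAdd 7 (0 : Fin 5)),
      tpw_third_of_r4_slice κ' (fun l => decide (l = Fin.castAdd 7 (0 : Fin 5))) (Fin.castAdd 7 (1 : Fin 5)) (Fin.castAdd 7 (2 : Fin 5))
        (Fin.castAdd 7 (3 : Fin 5)) (Fin.castAdd 7 (4 : Fin 5)) hD' (fun l => decide (l = j)) (fun l => decide (l = k)) zeroVec]
    have hsplit : ∀ A B : Bool, (if (A ^^ B) = true then (1 : ZMod 2) else 0) =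
        (if A = true then (1 : ZMod 2) else 0) + (if B = true then (1 : ZMod 2) else 0) := by decide
    rw [hsplit]
    have hAC12 : (decide (Fin.castAdd 7 (1 : Fin 5) = j) && decide (Fin.castAdd 7 (2 : Fin 5) = j)) = false := by
      by_cases hj : Fin.castAdd 7 (1 : Fin 5) = j
      · have hj' : ¬ Fin.castAdd 7 (2 : Fin 5) = j := fun h' => hne 1 2 (by decide) (hj.trans h'.symm)
        rw [decide_eq_false hj', Bool.and_false]
      · rw [decide_eq_false hj, Bool.false_and]
    have hAC34 : (decide (Fin.castAdd 7 (3 : Fin 5) = j) && decide (Fin.castAdd 7 (4 : Fin 5) = j)) = false := by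
      by_cases hj : Fin.castAdd 7 (3 : Fin 5) = j
      · have hj' : ¬ Fin.castAdd 7 (4 : Fin 5) = j := fun h' => hne 3 4 (by decide) (hj.trans h'.symm)
        rw [decide_eq_false hj', Bool.and_false]
      · rw [decide_eq_false hj, Bool.false_and]
    have hkey : ∀ (s s' : Fin 5), (decide (Fin.castAdd 7 s = j) && decide (Fin.castAdd 7 s' = j)) = false →
        (if ((decide (Fin.castAdd 7 s = j) && decide (Fin.castAdd 7 s' = k)) ^^
              (decide (Fin.castAdd 7 s' = j) && decide (Fin.castAdd 7 s = k))) = true then (1 : ZMod 2) else 0) =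
          if (j = Fin.castAdd 7 s ∧ k = Fin.castAdd 7 s') ∨ (j = Fin.castAdd 7 s' ∧ k = Fin.castAdd 7 s) then 1 else 0 := by
      intro s s' hAC
      have key : ∀ A B C D : Bool, (A && C) = false →
          ((if ((A && B) ^^ (C && D)) = true then (1 : ZMod 2) else 0) =
            if (A = true ∧ B = true) ∨ (C = true ∧ D = true) then 1 else 0) := by decide
      rw [key _ _ _ _ hAC]
      simp only [decide_eq_true_eq]
      have hiff : ((Fin.castAdd 7 s = j ∧ Fin.castAdd 7 s' = k) ∨ (Fin.castAdd 7 s' = j ∧ Fin.castAdd 7 s = k)) ↔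
          ((j = Fin.castAdd 7 s ∧ k = Fin.castAdd 7 s') ∨ (j = Fin.castAdd 7 s' ∧ k = Fin.castAdd 7 s)) := by
        constructor
        · rintro (⟨h1, h2⟩ | ⟨h1, h2⟩)
          · exact Or.inl ⟨h1.symm, h2.symm⟩
          · exact Or.inr ⟨h1.symm, h2.symm⟩
        · rintro (⟨h1, h2⟩ | ⟨h1, h2⟩)
          · exact Or.inl ⟨h1.symm, h2.symm⟩
          · exact Or.inr ⟨h1.symm, h2.symm⟩
      simp only [hiff]
    rw [hkey 1 2 hAC12, hkey 3 4 hAC34]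

end Summit.QuantumAdvantage.QuantumAdvantage.Theorems.CubicForrelation.NearExactIsExact
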